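import Literature.Geometry.Riemannian.HeatKernelBasePointVeryWeak
import Literature.Geometry.Riemannian.LinearHeatVeryWeakUniformBound
import Literature.Geometry.Riemannian.LinearHeatVeryWeakClassical
import HarnessLib

/-!
# The conjugate heat kernel is smooth in the base point and solves the heat equation there
# (Bamler 2020a, §2.3: `∂ₜ K(x,t;y,s) = Δ_{x,h(t)} K(x,t;y,s)`)

R. Bamler, *Entropy and heat kernel bounds on a Ricci flow background*, arXiv:2008.07093 (2020a),
§2.3. For the kernel function `𝒦 t x (y, s)` of `HeatKernelBasePointContinuity.lean` (the
densities of the heat kernel measures `ν_{x,t;s}` of all base times `t ∈ (a, T]`), and every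
`(y, s)` with `s ∈ (a, T)`, the function `(x, t) ↦ 𝒦 t x (y, s)` is `C^∞` on `M × (s, T)` and
solves the heat equation `∂ₜ = Δ_{x,h(t)}` there:

* `contMDiffOn_conjugateHeatKernel_timeFamily_basePoint`,
* `deriv_conjugateHeatKernel_timeFamily_basePoint`.

Proof: the very weak equation in `(x, t)` (`integral_conjugateHeatKernel_timeFamily_mul_heatAdjoint_eq_zero`),
Hörmander's interior regularity on the closed manifold
(`exists_contMDiffOn_ae_eq_of_linearHeat_veryWeak`), uniqueness of continuous representatives
(`eqOn_of_ae_eq_of_continuousOn`, continuity from `continuousOn_conjugateHeatKernel_timeFamily_basePoint`),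
and the classical equation for smooth very weak solutions
(`linearHeat_classical_of_veryWeak_of_contMDiffOn`). Everything is proved; no definitions, no
named facts.

## References

* R. H. Bamler, *Entropy and heat kernel bounds on a Ricci flow background*, arXiv:2008.07093
  (2020), §2.3. [Bamler2020Entropy]
* L. Hörmander, *Hypoelliptic second order differential equations*, Acta Math. 119 (1967).
  [Hormander1967]
-/

noncomputable section

open Bundle Set Function Filter Manifold MeasureTheory Measure TopologicalSpace
open scoped Manifold ContDiff Topology ENNReal NNReal

namespace Literature.Geometry.Riemannian

open Lorentzian Lorentzian.PseudoRiemannianMetric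

section BasePointSmooth

variable {m : ℕ} {H : Type*} [TopologicalSpace H]
  {I : ModelWithCorners ℝ (EuclideanSpace ℝ (Fin m)) H} [I.Boundaryless]
  {M : Type*} [TopologicalSpace M] [ChartedSpace H M] [IsManifold I ∞ M]
  [T2Space M] [CompactSpace M] [SecondCountableTopology M] [MeasurableSpace M] [BorelSpace M]
  {h : ℝ → PseudoRiemannianMetric I ∞ (EuclideanSpace ℝ (Fin m)) (TangentSpace I : M → Type _)}
  (hh : IsContMDiffFamilyOn ∞ h univ) (hR : ∀ r, (h r).IsRiemannian)

include hh hR in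
/-- **`K(x,t;y,s)` is `C^∞` in `(x, t)` and solves `∂ₜK = Δ_{x,h(t)}K`** (Bamler 2020a, §2.3). Let
`𝒦 t x (y, s)`, `t ∈ (a, T]`, be nonnegative jointly continuous densities of the heat kernel
measures `ν_{x,t;s}`, `s ∈ (a, t)`, of a `C^∞` family of Riemannian metrics on a closed manifold
(`IsRicciFlow.exists_conjugateHeatKernel_timeFamily`), `s ∈ (a, T)`, `y ∈ M`. Then
`(x, t) ↦ 𝒦 t x (y, s)` is `C^∞` on `M × (s, T)` and
`∂ₜ 𝒦 t x (y, s) = Δ_{h(t)} (𝒦 t · (y, s))(x)` there. [cite: Bamler2020Entropy, §2.3]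
[cite: Hormander1967, Thm 1.1] -/
theorem contMDiffOn_and_deriv_conjugateHeatKernel_timeFamily_basePoint {a T : ℝ}
    {𝒦 : ℝ → M → M × ℝ → ℝ}
    (h𝒦0 : ∀ t ∈ Ioc a T, ∀ x, ∀ p ∈ univ ×ˢ Ioo a t, 0 ≤ 𝒦 t x p)
    (h𝒦ν : ∀ t ∈ Ioc a T, ∀ x, ∀ s ∈ Ioo a t, heatKernelMeasure hh hR t x s =
      (h s).riemVolume.withDensity fun y ↦ ENNReal.ofReal (𝒦 t x (y, s)))
    (h𝒦c : ∀ t ∈ Ioc a T, ContinuousOn (fun q : M × (M × ℝ) ↦ 𝒦 t q.1 q.2)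
      (univ ×ˢ (univ ×ˢ Ioo a t)))
    {s : ℝ} (hs : s ∈ Ioo a T) (y : M) :
    ContMDiffOn (I.prod 𝓘(ℝ, ℝ)) 𝓘(ℝ, ℝ) ∞ (fun p : M × ℝ ↦ 𝒦 p.2 p.1 (y, s)) (univ ×ˢ Ioo s T) ∧
      ∀ p ∈ (univ : Set M) ×ˢ Ioo s T, deriv (fun t ↦ 𝒦 t p.1 (y, s)) p.2 =
        (h p.2).laplaceBeltrami (fun x ↦ 𝒦 p.2 x (y, s)) p.1 := by
  classical
  -- reference metric `g₀ = h s`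
  set g₀ := h s with hg₀
  have hR₀ : g₀.IsRiemannian := hR s
  set μ₀ : Measure M := g₀.riemVolume with hμ₀
  haveI : IsFiniteMeasure μ₀ := ⟨by rw [hμ₀]; exact g₀.riemVolume_univ_lt_top⟩
  haveI : μ₀.IsOpenPosMeasure := by
    rw [hμ₀, riemVolume_eq hR₀]; exact isOpenPosMeasure_riemannianMeasure _
  set ν : Measure (M × ℝ) := μ₀.prod (volume : Measure ℝ) with hν
  haveI : ν.IsOpenPosMeasure := prod.instIsOpenPosMeasure
  set O : Set (M × ℝ) := univ ×ˢ Ioo s T with hO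
  have hOo : IsOpen O := isOpen_univ.prod isOpen_Ioo
  have hOm : MeasurableSet O := hOo.measurableSet
  -- the function and its measurable extension by zero
  set u : M × ℝ → ℝ := fun p ↦ 𝒦 p.2 p.1 (y, s) with hu
  have huc : ContinuousOn u O :=
    (continuousOn_conjugateHeatKernel_timeFamily_basePoint hh hR h𝒦0 h𝒦ν h𝒦c hs y).mono
      (prod_mono le_rfl Ioo_subset_Ioc_self)
  set ū : M × ℝ → ℝ := O.piecewise u 0 with hū
  have hūu : ∀ p ∈ O, ū p = u p := fun p hp ↦ Set.piecewise_eq_of_mem _ _ _ hp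
  have hū0 : ∀ p ∉ O, ū p = 0 := fun p hp ↦ Set.piecewise_eq_of_notMem _ _ _ hp
  have hūm : Measurable ū := huc.measurable_piecewise continuousOn_const hOm
  have hūc : ContinuousOn ū O := huc.congr fun p hp ↦ hūu p hp
  have hūloc : LocallyIntegrableOn ū O ν := hūc.locallyIntegrableOn hOm
  -- the very weak equation (`Q = 0`, `G = 0`), for `u` and for `ū`
  have hweak0 := fun (ζ : M × ℝ → ℝ) (hζ : ContMDiff (I.prod 𝓘(ℝ, ℝ)) 𝓘(ℝ, ℝ) ∞ ζ)
    (hζc : HasCompactSupport ζ) (hζT : tsupport ζ ⊆ O) ↦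
    integral_conjugateHeatKernel_timeFamily_mul_heatAdjoint_eq_zero hh hR hR₀ h𝒦0 h𝒦ν h𝒦c hs y
      hζ hζc hζT
  have hbr0 : ∀ {ζ : M × ℝ → ℝ} (p : M × ℝ), p ∉ tsupport ζ →
      -(deriv (fun t ↦ (h t).densityRatio g₀ p.1 * ζ (p.1, t)) p.2) -
        (h p.2).densityRatio g₀ p.1 * (h p.2).laplaceBeltrami (fun x ↦ ζ (x, p.2)) p.1 = 0 := by
    intro ζ p hp
    have h0 := heatAdjoint_eq_zero_of_notMem_tsupport (h := h) (g₀ := g₀)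
      (Q := fun (_ : ℝ) (_ : M) ↦ (0 : ℝ)) hp
    simpa using h0
  have hweak : ∀ (w : M × ℝ → ℝ), (∀ p ∈ O, w p = u p) →
      ∀ ζ : M × ℝ → ℝ, ContMDiff (I.prod 𝓘(ℝ, ℝ)) 𝓘(ℝ, ℝ) ∞ ζ → HasCompactSupport ζ →
      tsupport ζ ⊆ univ ×ˢ Ioo s T →
      ∫ p, w p * (-(deriv (fun t ↦ (h t).densityRatio g₀ p.1 * ζ (p.1, t)) p.2) -
          (h p.2).densityRatio g₀ p.1 * (h p.2).laplaceBeltrami (fun x ↦ ζ (x, p.2)) p.1 +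
          (h p.2).densityRatio g₀ p.1 * (fun (_ : ℝ) (_ : M) ↦ (0 : ℝ)) p.2 p.1 * ζ p) ∂ν =
        ∫ p, (h p.2).densityRatio g₀ p.1 * (fun (_ : ℝ) (_ : M) ↦ (0 : ℝ)) p.2 p.1 * ζ p ∂ν := by
    intro w hw ζ hζ hζc hζT
    have e : ∀ p : M × ℝ, w p * (-(deriv (fun t ↦ (h t).densityRatio g₀ p.1 * ζ (p.1, t)) p.2) -
        (h p.2).densityRatio g₀ p.1 * (h p.2).laplaceBeltrami (fun x ↦ ζ (x, p.2)) p.1 +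
        (h p.2).densityRatio g₀ p.1 * (fun (_ : ℝ) (_ : M) ↦ (0 : ℝ)) p.2 p.1 * ζ p) =
        u p * (-(deriv (fun t ↦ (h t).densityRatio g₀ p.1 * ζ (p.1, t)) p.2) -
        (h p.2).densityRatio g₀ p.1 * (h p.2).laplaceBeltrami (fun x ↦ ζ (x, p.2)) p.1) := by
      intro p
      simp only [mul_zero, zero_mul, add_zero]
      by_cases hp : p ∈ tsupport ζ
      · rw [hw p (hζT hp)]
      · rw [hbr0 p hp, mul_zero, mul_zero]
    rw [integral_congr_ae (Eventually.of_forall e), hweak0 ζ hζ hζc hζT]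
    simp
  -- interior regularity: a smooth representative `v`, equal to `u` on `O` by continuity
  obtain ⟨v, hv, hae⟩ := exists_contMDiffOn_ae_eq_of_linearHeat_veryWeak hh hR hR₀
    (Q := fun (_ : ℝ) (_ : M) ↦ (0 : ℝ)) (G := fun (_ : ℝ) (_ : M) ↦ (0 : ℝ))
    contMDiff_const contMDiff_const isOpen_Ioo hūm hūloc (hweak ū hūu)
  have heq : EqOn ū v O := eqOn_of_ae_eq_of_continuousOn (μ := ν) hOo hūc hv.continuousOn hae
  have hus : ContMDiffOn (I.prod 𝓘(ℝ, ℝ)) 𝓘(ℝ, ℝ) ∞ u O :=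
    hv.congr fun p hp ↦ (hūu p hp).symm.trans (heq hp)
  refine ⟨hus, fun p hp ↦ ?_⟩
  -- the classical equation for the smooth very weak solution `u`
  have hcl := linearHeat_classical_of_veryWeak_of_contMDiffOn hh hR hR₀
    (Q := fun (_ : ℝ) (_ : M) ↦ (0 : ℝ)) (G := fun (_ : ℝ) (_ : M) ↦ (0 : ℝ))
    contMDiff_const contMDiff_const isOpen_Ioo hus (hweak u fun _ _ ↦ rfl) p hp
  simp only [zero_mul, add_zero, sub_eq_zero] at hcl
  simpa [hu] using hcl

end BasePointSmooth

end Literature.Geometry.Riemannian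

end
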